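import Summits.NavierStokesRegularity.NavierStokesRegularity.Theorems.EulerZoomLiouvillePowerGaugeEulerLiouvilleWeakRenormalizedTransportMember
import Summits.NavierStokesRegularity.NavierStokesRegularity.Theorems.EulerZoomLiouvillePowerGaugeEulerLiouvilleSelfSimilarHighSetFluxTools

/-!
# «JETS MUST TURN» IN THE WEAK CLASS, tools: the EXIT LAW of a Bernoulli high set between two sphere layers, the mass between
# layers, the size of the outer flux, tails — for weak class profiles (no regularity, no flow)
# (crux `EulerZoomLiouville.PowerGaugeEulerLiouville` = stmt-NavierStokesRegularity-19832, line `birth`, open stub `stub_selfSimilarWeakRest`)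

Width seat `ns-ezl-w1` (g7) under the crux LEAD.  Weak-class port of g5's `…SelfSimilarHighSetFluxTools` / `…SelfSimilarHighSetFlux`
(«JETS MUST TURN», there for `C²` profiles and `C¹` weights non-increasing along `W`).  Here the weight is the SHARP indicator of the high
set `S = {ℋ > h}` of a weak class profile and its monotonicity along `W` is the Eulerian backward-invariance
`div(𝟙_S W) ≤ 𝟙_S div W` of `…WeakRenormalizedTransport` (`highSet_transport_ineq`).  With the Tao cutoffs `θ_{R,r}`
(`Dθ_{R,r}(x)[w] = −k(x)⟪x,w⟫`, `k ≥ 0` on the layer `R(R−r) ≤ |x|² ≤ R²`) the OUTWARD RADIAL `W`-FLUX OF THE HIGH SET through the layer is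
`F_{R,r}(S) = ∫_S −Dθ_{R,r}[W] = ∫_S k⟪x, W⟫`, and:

* `WeakRenormalized.integrable_fderiv_taoCutoff_transport` — `x ↦ Dθ_{R,r}(x)[W x]` is integrable (`W ∈ L¹_loc`, `Dθ` bounded with compact support);
* **`WeakRenormalized.highSet_flux_exit_law`** — `F_out(S) − F_in(S) ≤ 3γ ∫_S (θ_out − θ_in)` for nested layers (`γ ≤ ½`): between two
  layers the flux of the high set grows at most by `3γ ×` its mass in between — the flow LEAVES the high set laterally;
* `WeakRenormalized.setIntegral_sub_taoCutoff_le` — `∫_S (θ_out − θ_in) ≤ vol(S ∩ {R(R−r) ≤ |x|²})`;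
* `WeakRenormalized.abs_highSet_flux_le` — `|F_{R,r}(S)| ≤ (2M/(rR))·[(R²/2 + γ²R²)·vol(S ∩ layer) + ∫_{B_{2R}}‖V‖²]` (`|S′| ≤ M`);
* `WeakRenormalized.tendsto_volume_inter_far_zero₀` — tails of a finite-volume null-measurable set vanish.

The assembled turning law `F_{R,r}(S) ≥ −3γ·vol(S ∩ far)` and its member level are in `…WeakHighSetFlux`.
WHAT THIS IS NOT: not NS, not E, not the stub — weak-class TOOLS (`--supports` stmt-19832); no summit statement is proved here.
[folklore; ConstantinIgnatovaVicol2026Putative §3.4.1 (3.22), §3.4.3 (3.33); Leray1934 §6 (1.11); Tao2011 §8 (58)]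
-/

noncomputable section

set_option linter.dupNamespace false
-- nested operator types (`innerSL … ∘L …`)
set_option maxSynthPendingDepth 3

open MeasureTheory Set Filter Topology Metric Function TopologicalSpace
open scoped ENNReal NNReal RealInnerProductSpace ContDiff

namespace Summit.NavierStokesRegularity.NavierStokesRegularity.Theorems.PowerGaugeEulerLiouville

open Literature.Analysis Literature.Analysis.FunctionSpaces Literature.Analysis.FluidPDE

namespace WeakRenormalized

variable {V : EuclideanSpace ℝ (Fin 3) → EuclideanSpace ℝ (Fin 3)} {P : EuclideanSpace ℝ (Fin 3) → ℝ}
  {G : EuclideanSpace ℝ (Fin 3) → EuclideanSpace ℝ (Fin 3) →L[ℝ] EuclideanSpace ℝ (Fin 3)}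

/-! ## The flux integrand -/

section FluxIntegrand

/-- The Tao cutoff `θ_{R,r}` is a test function on `ℝ³` (`0 ≤ r`, `0 ≤ R`). [folklore] -/
theorem isTestFunctionOn_taoCutoff {R r : ℝ} (hR : 0 ≤ R) (hr : 0 ≤ r) :
    IsTestFunctionOn (⊤ : Opens (EuclideanSpace ℝ (Fin 3))) (taoCutoff (E := EuclideanSpace ℝ (Fin 3)) R r) :=
  ⟨contDiff_taoCutoff _ _, hasCompactSupport_taoCutoff hR hr, fun _ _ => trivial⟩

/-- `x ↦ Dθ_{R,r}(x)[W x]` is integrable for `W = γy + V`, `V ∈ L¹_loc` (bounded compactly supported `Dθ`). [folklore] -/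
theorem integrable_fderiv_taoCutoff_transport {γ R r : ℝ} (hR : 0 ≤ R) (hr : 0 ≤ r) (hVl : LocallyIntegrable V volume) :
    Integrable (fun x => fderiv ℝ (taoCutoff R r) x (selfSimilarTransport γ 0 V x)) volume := by
  have hθ := isTestFunctionOn_taoCutoff (R := R) (r := r) hR hr
  refine Wu2026Salvage.integrable_clm_apply_of_tsupport_subset (U := univ) (hθ.contDiff.continuous_fderiv (by simp))
    (hθ.hasCompactSupport.fderiv (𝕜 := ℝ)) (subset_univ _) ?_
  exact (locallyIntegrable_transport (γ := γ) hVl).locallyIntegrableOn univ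

end FluxIntegrand

/-! ## The exit law of a high set between two layers -/

section Exit

/-- **THE EXIT LAW OF A BERNOULLI HIGH SET (weak class, `γ ≤ ½`).**  Under the hypotheses of `highSet_transport_ineq`, for nested Tao cutoffs
`θ_in = θ_{R₁,r₁} ≤ θ_out = θ_{R₂,r₂}` (`0 < rᵢ ≤ Rᵢ`, `R₁ ≤ R₂ − r₂`) and every level `h`, with `S = {ℋ > h}`:
`F_out(S) − F_in(S) ≤ 3γ ∫_S (θ_out − θ_in)`, where `F_{R,r}(S) = ∫_S −Dθ_{R,r}[W]` is the outward radial `W`-flux of the high set through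
the layer.  (`highSet_transport_ineq` tested with `θ_out − θ_in ≥ 0`.) [folklore; cf. ConstantinIgnatovaVicol2026Putative §3.4.1 (3.22), §3.4.3 (3.33)] -/
theorem highSet_flux_exit_law {γ : ℝ} (hγ : γ ≤ 1 / 2)
    (hV6 : ∀ r : ℝ, MemLp V 6 (volume.restrict (ball (0 : EuclideanSpace ℝ (Fin 3)) r)))
    (hG2 : ∀ r : ℝ, MemLp G 2 (volume.restrict (ball (0 : EuclideanSpace ℝ (Fin 3)) r)))
    (hP32 : ∀ r : ℝ, MemLp P (3 / 2 : ℝ≥0∞) (volume.restrict (ball (0 : EuclideanSpace ℝ (Fin 3)) r)))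
    (hdiv : IsWeaklyDivFree V)
    (hH : HasWeakFDerivOn (⊤ : Opens (EuclideanSpace ℝ (Fin 3))) volume (selfSimilarBernoulli γ 0 V P)
      (fun x => (2 * γ - 1) • innerSL ℝ (selfSimilarTransport γ 0 V x) +
        (innerSL ℝ (selfSimilarTransport γ 0 V x)).comp (G x) - innerSL ℝ (G x (selfSimilarTransport γ 0 V x))))
    (h : ℝ) {R₁ r₁ R₂ r₂ : ℝ} (hr₁ : 0 < r₁) (hr₁R : r₁ ≤ R₁) (hr₂ : 0 < r₂) (hr₂R : r₂ ≤ R₂) (hnest : R₁ ≤ R₂ - r₂) :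
    (∫ x in {x | h < selfSimilarBernoulli γ 0 V P x}, -(fderiv ℝ (taoCutoff R₂ r₂) x (selfSimilarTransport γ 0 V x))) -
        ∫ x in {x | h < selfSimilarBernoulli γ 0 V P x}, -(fderiv ℝ (taoCutoff R₁ r₁) x (selfSimilarTransport γ 0 V x)) ≤
      3 * γ * ∫ x in {x | h < selfSimilarBernoulli γ 0 V P x}, (taoCutoff R₂ r₂ x - taoCutoff R₁ r₁ x) := by
  set S : Set (EuclideanSpace ℝ (Fin 3)) := {x | h < selfSimilarBernoulli γ 0 V P x} with hSdef
  set W : EuclideanSpace ℝ (Fin 3) → EuclideanSpace ℝ (Fin 3) := selfSimilarTransport γ 0 V with hWdef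
  have hR₁ : 0 < R₁ := hr₁.trans_le hr₁R
  have hR₂ : 0 < R₂ := hr₂.trans_le hr₂R
  have hVl : LocallyIntegrable V volume := WeakBernoulli.locallyIntegrable_of_memLp_six_ball hV6
  set τ : EuclideanSpace ℝ (Fin 3) → ℝ := fun x => taoCutoff R₂ r₂ x - taoCutoff R₁ r₁ x with hτdef
  have hθ₁ : ContDiff ℝ ∞ (taoCutoff (E := EuclideanSpace ℝ (Fin 3)) R₁ r₁) := contDiff_taoCutoff R₁ r₁
  have hθ₂ : ContDiff ℝ ∞ (taoCutoff (E := EuclideanSpace ℝ (Fin 3)) R₂ r₂) := contDiff_taoCutoff R₂ r₂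
  have hτc : HasCompactSupport τ := by
    refine HasCompactSupport.of_support_subset_isCompact (isCompact_closedBall (0 : EuclideanSpace ℝ (Fin 3)) R₂)
      fun x hx => ?_
    rw [mem_closedBall, dist_zero_right]
    by_contra hxR
    refine hx ?_
    have h2 : R₂ ≤ ‖x‖ := (not_le.1 hxR).le
    simp only [hτdef, taoCutoff_eq_zero hR₂.le hr₂.le h2, taoCutoff_eq_zero hR₁.le hr₁.le (by linarith), sub_zero]
  have hτt : IsTestFunctionOn (⊤ : Opens (EuclideanSpace ℝ (Fin 3))) τ := ⟨hθ₂.sub hθ₁, hτc, fun _ _ => trivial⟩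
  have hτ0 : ∀ x, 0 ≤ τ x := fun x => sub_nonneg.2 (HighSetFlux.taoCutoff_le_taoCutoff hr₁ hr₁R hr₂ hr₂R hnest x)
  have hineq := highSet_transport_ineq hγ hV6 hG2 hP32 hdiv hH h hτt hτ0
  -- split the gradient of `τ`
  have hdτ : ∀ x, ⟪W x, gradient τ x⟫ = fderiv ℝ (taoCutoff R₂ r₂) x (W x) - fderiv ℝ (taoCutoff R₁ r₁) x (W x) := fun x => by
    rw [inner_gradient_eq_fderiv]
    simp only [hτdef]
    rw [fderiv_fun_sub ((hθ₂.differentiable (by simp)) x) ((hθ₁.differentiable (by simp)) x)]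
    rfl
  have hi₁ := (integrable_fderiv_taoCutoff_transport (γ := γ) hR₁.le hr₁.le hVl).integrableOn (s := S)
  have hi₂ := (integrable_fderiv_taoCutoff_transport (γ := γ) hR₂.le hr₂.le hVl).integrableOn (s := S)
  have hsplit : (∫ x in S, ⟪W x, gradient τ x⟫) =
      (∫ x in S, fderiv ℝ (taoCutoff R₂ r₂) x (W x)) - ∫ x in S, fderiv ℝ (taoCutoff R₁ r₁) x (W x) := by
    rw [← integral_sub hi₂ hi₁]
    exact integral_congr_ae (Eventually.of_forall hdτ)
  rw [integral_neg, integral_neg]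
  rw [hsplit] at hineq
  linarith

/-- **The mass between two layers**: `∫_S (θ_{R₂,r₂} − θ_{R,r}) ≤ vol(S ∩ {R(R−r) ≤ |x|²})` for nested cutoffs, when the far part of
`S` has finite volume (the integrand is `≤ 1` and vanishes on the core `|x|² < R(R−r)` where `θ_{R,r} = 1 ≥ θ_{R₂,r₂}`). [folklore] -/
theorem setIntegral_sub_taoCutoff_le {S : Set (EuclideanSpace ℝ (Fin 3))}
    {R r R₂ r₂ : ℝ} (hr : 0 < r) (hrR : r ≤ R) (hr₂ : 0 < r₂) (hr₂R : r₂ ≤ R₂)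
    (hfin : volume (S ∩ {x : EuclideanSpace ℝ (Fin 3) | R * (R - r) ≤ ‖x‖ ^ 2}) < ⊤) :
    (∫ x in S, (taoCutoff R₂ r₂ x - taoCutoff R r x)) ≤
      (volume (S ∩ {x : EuclideanSpace ℝ (Fin 3) | R * (R - r) ≤ ‖x‖ ^ 2})).toReal := by
  set far : Set (EuclideanSpace ℝ (Fin 3)) := {x | R * (R - r) ≤ ‖x‖ ^ 2} with hfar
  have hR : 0 < R := hr.trans_le hrR
  have hR₂ : 0 < R₂ := hr₂.trans_le hr₂R
  have hfarm : MeasurableSet far := (isClosed_le continuous_const (continuous_norm.pow 2)).measurableSet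
  have hvol : (volume.restrict S) far = volume (S ∩ far) := by rw [Measure.restrict_apply hfarm, inter_comm]
  have hfin' : (volume.restrict S) far ≠ ⊤ := by rw [hvol]; exact hfin.ne
  -- pointwise bound
  have hpt : ∀ x, taoCutoff R₂ r₂ x - taoCutoff R r x ≤ far.indicator (fun _ => (1 : ℝ)) x := by
    intro x
    by_cases hx : x ∈ far
    · rw [indicator_of_mem hx]
      linarith [taoCutoff_le_one R₂ r₂ x, taoCutoff_nonneg R r x]
    · rw [indicator_of_notMem hx]
      have hx' : ‖x‖ ^ 2 ≤ R * (R - r) := (not_le.1 hx).le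
      rw [taoCutoff_eq_one hR hr hx']
      linarith [taoCutoff_le_one R₂ r₂ x]
  -- integrability
  have hτc : Continuous fun x : EuclideanSpace ℝ (Fin 3) => taoCutoff R₂ r₂ x - taoCutoff R r x :=
    (continuous_taoCutoff _ _).sub (continuous_taoCutoff _ _)
  have hτcs : HasCompactSupport fun x : EuclideanSpace ℝ (Fin 3) => taoCutoff R₂ r₂ x - taoCutoff R r x := by
    refine HasCompactSupport.of_support_subset_isCompact (isCompact_closedBall (0 : EuclideanSpace ℝ (Fin 3)) (max R R₂))
      fun x hx => ?_
    rw [mem_closedBall, dist_zero_right]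
    by_contra hxR
    refine hx ?_
    have h2 : max R R₂ ≤ ‖x‖ := (not_le.1 hxR).le
    simp only [taoCutoff_eq_zero hR₂.le hr₂.le ((le_max_right _ _).trans h2),
      taoCutoff_eq_zero hR.le hr.le ((le_max_left _ _).trans h2), sub_zero]
  have hτi : IntegrableOn (fun x => taoCutoff R₂ r₂ x - taoCutoff R r x) S volume :=
    (hτc.integrable_of_hasCompactSupport hτcs).integrableOn
  have hind : Integrable (far.indicator fun _ => (1 : ℝ)) (volume.restrict S) :=
    (integrableOn_const (hs := hfin')).integrable_indicator hfarm
  calc (∫ x in S, (taoCutoff R₂ r₂ x - taoCutoff R r x)) ≤ ∫ x in S, far.indicator (fun _ => (1 : ℝ)) x :=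
        integral_mono hτi hind hpt
    _ = (volume (S ∩ far)).toReal := by
        rw [integral_indicator hfarm, setIntegral_const, smul_eq_mul, mul_one, measureReal_def, Measure.restrict_apply hfarm,
          inter_comm]

end Exit

/-! ## The size of the outer flux -/

section Outer

/-- **THE OUTER FLUX OF THE HIGH SET IS SMALL ON THIN SETS.**  For any `S`, `0 < r ≤ R`, `|S′| ≤ M`, `V ∈ L²(B(0,2R))`, and
`A = S ∩ {R(R−r) ≤ |x|² ∧ |x| ≤ R}` (the part of the layer inside `S`):
`|∫_S −Dθ_{R,r}[W]| ≤ (2M/(rR)) · ((R²/2 + γ²R²)·vol A + ∫_{B(0,2R)} ‖V‖²)`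
(pointwise `|Dθ[W]| ≤ (2M/(rR))|⟪x,W⟫| ≤ (2M/(rR))(R²/2 + ‖W‖²/2)` on the layer, `0` off it, `‖W‖² ≤ 2γ²R² + 2‖V‖²`). [folklore] -/
theorem abs_highSet_flux_le {γ : ℝ} {S : Set (EuclideanSpace ℝ (Fin 3))} {R r M : ℝ} (hr : 0 < r) (hrR : r ≤ R)
    (hM : ∀ s, |deriv Real.smoothTransition s| ≤ M)
    (hV2 : MemLp V 2 (volume.restrict (ball (0 : EuclideanSpace ℝ (Fin 3)) (2 * R)))) :
    |∫ x in S, -(fderiv ℝ (taoCutoff R r) x (selfSimilarTransport γ 0 V x))| ≤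
      2 * M / (r * R) * ((R ^ 2 / 2 + γ ^ 2 * R ^ 2) *
          (volume (S ∩ {x : EuclideanSpace ℝ (Fin 3) | R * (R - r) ≤ ‖x‖ ^ 2 ∧ ‖x‖ ≤ R})).toReal +
        ∫ x in ball (0 : EuclideanSpace ℝ (Fin 3)) (2 * R), ‖V x‖ ^ 2) := by
  set W : EuclideanSpace ℝ (Fin 3) → EuclideanSpace ℝ (Fin 3) := selfSimilarTransport γ 0 V with hWdef
  set layer : Set (EuclideanSpace ℝ (Fin 3)) := {x | R * (R - r) ≤ ‖x‖ ^ 2 ∧ ‖x‖ ≤ R} with hlayer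
  have hR : 0 < R := hr.trans_le hrR
  have hM0 : 0 ≤ M := (abs_nonneg _).trans (hM 0)
  have hK : 0 ≤ 2 * M / (r * R) := by positivity
  have hlayerm : MeasurableSet layer :=
    ((isClosed_le continuous_const (continuous_norm.pow 2)).inter (isClosed_le continuous_norm continuous_const)).measurableSet
  have hlayB : layer ⊆ ball (0 : EuclideanSpace ℝ (Fin 3)) (2 * R) := fun x hx => by
    rw [mem_ball, dist_zero_right]; linarith [hx.2]
  haveI : IsFiniteMeasure ((volume : Measure (EuclideanSpace ℝ (Fin 3))).restrict (ball 0 (2 * R))) :=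
    isFiniteMeasure_restrict.2 measure_ball_lt_top.ne
  have hIV2 : IntegrableOn (fun x => ‖V x‖ ^ 2) (ball (0 : EuclideanSpace ℝ (Fin 3)) (2 * R)) volume :=
    (memLp_two_iff_integrable_sq_norm hV2.1).1 hV2
  -- the dominating function on `volume.restrict S`
  set K₁ : ℝ := 2 * M / (r * R) * (R ^ 2 / 2 + γ ^ 2 * R ^ 2) with hK₁
  set K₂ : ℝ := 2 * M / (r * R) with hK₂
  set g : EuclideanSpace ℝ (Fin 3) → ℝ := layer.indicator fun x => K₁ + K₂ * ‖V x‖ ^ 2 with hgdef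
  have hGi : IntegrableOn (fun x => K₁ + K₂ * ‖V x‖ ^ 2) (ball (0 : EuclideanSpace ℝ (Fin 3)) (2 * R)) volume :=
    (integrableOn_const (hs := measure_ball_lt_top.ne)).add (hIV2.const_mul _)
  have hvolAS : volume (layer ∩ S) ≤ volume (ball (0 : EuclideanSpace ℝ (Fin 3)) (2 * R)) :=
    measure_mono (inter_subset_left.trans hlayB)
  have hgi : Integrable g (volume.restrict S) := by
    rw [hgdef, integrable_indicator_iff hlayerm, IntegrableOn, Measure.restrict_restrict hlayerm]
    exact hGi.mono_set (inter_subset_left.trans hlayB)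
  have hpt : ∀ x, ‖-(fderiv ℝ (taoCutoff R r) x (W x))‖ ≤ g x := by
    intro x
    rw [norm_neg, Real.norm_eq_abs]
    by_cases hx : x ∈ layer
    · rw [hgdef, indicator_of_mem hx]
      have h2 := HighSetFlux.abs_fderiv_taoCutoff_apply_le hr hR hM x (W x)
      have h3 : |⟪x, W x⟫| ≤ R * ‖W x‖ :=
        (abs_real_inner_le_norm _ _).trans (mul_le_mul_of_nonneg_right hx.2 (norm_nonneg _))
      have h4 : R * ‖W x‖ ≤ R ^ 2 / 2 + ‖W x‖ ^ 2 / 2 := by nlinarith [sq_nonneg (R - ‖W x‖)]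
      have h5 : ‖W x‖ ^ 2 ≤ 2 * γ ^ 2 * ‖x‖ ^ 2 + 2 * ‖V x‖ ^ 2 := HighSetFlux.norm_selfSimilarTransport_sq_le γ V x
      have h6 : ‖x‖ ^ 2 ≤ R ^ 2 := by nlinarith [norm_nonneg x, hx.2]
      calc |fderiv ℝ (taoCutoff R r) x (W x)| ≤ 2 * M / (r * R) * |⟪x, W x⟫| := h2
        _ ≤ 2 * M / (r * R) * (R ^ 2 / 2 + (2 * γ ^ 2 * R ^ 2 + 2 * ‖V x‖ ^ 2) / 2) := by
            refine mul_le_mul_of_nonneg_left (h3.trans (h4.trans ?_)) hK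
            nlinarith [sq_nonneg γ]
        _ = K₁ + K₂ * ‖V x‖ ^ 2 := by rw [hK₁, hK₂]; ring
    · rw [hgdef, indicator_of_notMem hx, HighSetFlux.fderiv_taoCutoff_apply_eq_zero_of_not_mem_layer hr hR hx, abs_zero]
  have hmain := norm_integral_le_of_norm_le hgi (Eventually.of_forall hpt)
  rw [Real.norm_eq_abs] at hmain
  refine hmain.trans ?_
  -- evaluate `∫ g ∂(volume.restrict S)`
  have hAfin : volume (layer ∩ S) ≠ ⊤ := (hvolAS.trans_lt measure_ball_lt_top).ne
  have e1 : ∫ x in S, g x = ∫ x in layer ∩ S, (K₁ + K₂ * ‖V x‖ ^ 2) := by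
    rw [hgdef, integral_indicator hlayerm, Measure.restrict_restrict hlayerm]
  have hIV2A : IntegrableOn (fun x => ‖V x‖ ^ 2) (layer ∩ S) volume := hIV2.mono_set (inter_subset_left.trans hlayB)
  have hIcA : IntegrableOn (fun _ : EuclideanSpace ℝ (Fin 3) => K₁) (layer ∩ S) volume := integrableOn_const (hs := hAfin)
  have e2 : ∫ x in layer ∩ S, (K₁ + K₂ * ‖V x‖ ^ 2) = K₁ * (volume (layer ∩ S)).toReal + K₂ * ∫ x in layer ∩ S, ‖V x‖ ^ 2 := by
    rw [integral_add hIcA (hIV2A.const_mul _), setIntegral_const, integral_const_mul, smul_eq_mul, measureReal_def, mul_comm]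
  have e3 : ∫ x in layer ∩ S, ‖V x‖ ^ 2 ≤ ∫ x in ball (0 : EuclideanSpace ℝ (Fin 3)) (2 * R), ‖V x‖ ^ 2 :=
    setIntegral_mono_set hIV2 (Eventually.of_forall fun x => by positivity) (Eventually.of_forall (inter_subset_left.trans hlayB))
  rw [e1, e2, Set.inter_comm S layer]
  have hK₁0 : 0 ≤ K₁ := by positivity
  calc K₁ * (volume (layer ∩ S)).toReal + K₂ * ∫ x in layer ∩ S, ‖V x‖ ^ 2
      ≤ K₁ * (volume (layer ∩ S)).toReal + K₂ * ∫ x in ball (0 : EuclideanSpace ℝ (Fin 3)) (2 * R), ‖V x‖ ^ 2 := by gcongr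
    _ = 2 * M / (r * R) * ((R ^ 2 / 2 + γ ^ 2 * R ^ 2) * (volume (layer ∩ S)).toReal +
          ∫ x in ball (0 : EuclideanSpace ℝ (Fin 3)) (2 * R), ‖V x‖ ^ 2) := by rw [hK₁, hK₂]; ring

end Outer

/-! ## Tails -/

section Tails

/-- Tails of a finite-volume null-measurable set: `vol(S ∩ {n²/2 ≤ |x|²}) → 0` as `n → ∞`. [folklore] -/
theorem tendsto_volume_inter_far_zero₀ {S : Set (EuclideanSpace ℝ (Fin 3))} (hS : NullMeasurableSet S volume) (hfin : volume S < ⊤) :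
    Tendsto (fun n : ℕ => (volume (S ∩ {x : EuclideanSpace ℝ (Fin 3) | (n : ℝ) ^ 2 / 2 ≤ ‖x‖ ^ 2})).toReal) atTop (𝓝 0) := by
  set T : ℕ → Set (EuclideanSpace ℝ (Fin 3)) := fun n => S ∩ {x | (n : ℝ) ^ 2 / 2 ≤ ‖x‖ ^ 2} with hTdef
  have hTm : ∀ n, NullMeasurableSet (T n) volume := fun n =>
    hS.inter (isClosed_le continuous_const (continuous_norm.pow 2)).measurableSet.nullMeasurableSet
  have hanti : Antitone T := by
    intro m n hmn x hx
    refine ⟨hx.1, ?_⟩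
    have h1 : ((m : ℝ)) ^ 2 / 2 ≤ (n : ℝ) ^ 2 / 2 := by
      have : (m : ℝ) ≤ n := Nat.cast_le.2 hmn
      have hm0 : (0 : ℝ) ≤ m := Nat.cast_nonneg m
      nlinarith
    exact h1.trans hx.2
  have hempty : (⋂ n, T n) = ∅ := by
    refine eq_empty_iff_forall_notMem.2 fun x hx => ?_
    rw [mem_iInter] at hx
    obtain ⟨n, hn⟩ := exists_nat_gt (2 * ‖x‖ + 2)
    have h : (n : ℝ) ^ 2 / 2 ≤ ‖x‖ ^ 2 := (hx n).2
    have hx0 : 0 ≤ ‖x‖ := norm_nonneg x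
    have hsq : (2 * ‖x‖ + 2) ^ 2 < (n : ℝ) ^ 2 := by
      have h0 : 0 ≤ 2 * ‖x‖ + 2 := by positivity
      nlinarith
    nlinarith
  have hlim := tendsto_measure_iInter_atTop hTm hanti ⟨0, ((measure_mono inter_subset_left).trans_lt hfin).ne⟩
  rw [hempty, measure_empty] at hlim
  have h2 := (ENNReal.tendsto_toReal ENNReal.zero_ne_top).comp hlim
  rw [ENNReal.toReal_zero] at h2
  exact h2

end Tails

end WeakRenormalized

end Summit.NavierStokesRegularity.NavierStokesRegularity.Theorems.PowerGaugeEulerLiouville
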